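import Summits.Ventures.PackingBounds.Energy.CrossPolytopeUniversal
import Summits.Ventures.PackingBounds.Energy.TangentLineUniversal

/-!
# Inverse-square energy: the cross-polytope and simplex bounds in EVERY dimension `n ≥ 3`

Framing: lottery ticket; floor = certified bounds/negative ranges. Venture `PackingBounds` (cell
`pub-packcert`, seat `pub-packcert-energy`), energy-minimisation family, **universal + controls**
(one theorem for all dimensions; the per-dimension files `DimensionThreeOctahedron.lean` (27/2)
and the sharp simplex rows are the instances `n = 3, 4, …`).

For the potential `a(t) = (2 - 2t)⁻¹ = |x - y|⁻²`:

* **Cross-polytope.** `κ = a(-1) - a(0) + a'(0) = 1/4 - 1/2 + 1/2 = 1/4`, the Hermite minorant is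
  `q(t) = 1/2 + t/2 + t²/4` and `1 - (2 - 2t) q(t) = t² (1 + t) / 2 ≥ 0` on `[-1, 1]`; hence by
  `crossPolytope_energy_ge` every `2n` unit vectors of `ℝⁿ` have
  `Σ_{x ≠ y} |x - y|⁻² ≥ 2n (2(n-1)·(1/2) + 1/4) = 2n² - 3n/2`, attained by the regular
  cross-polytope (`n = 3`: `27/2`, `n = 4`: `26`).
* **Simplex.** With `t₀ = -1/(N-1)` the tangent line of the convex function `a` at `t₀` lies below
  `a`: `a(t) - a(t₀) - a'(t₀)(t - t₀) = (u₀ - u)² / (u u₀²) ≥ 0` with `u = 2 - 2t`, `u₀ = 2 - 2t₀`;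
  `tangent_energy_ge` then gives, for every `N ≥ 2` and all `N` unit vectors of `ℝⁿ`,
  `Σ_{x ≠ y} |x - y|⁻² ≥ N (N-1) a(-1/(N-1)) = (N - 1)² / 2`, attained by the regular simplex when
  `N ≤ n + 1` (`N = 4`: `9/2`, `N = 5` in `ℝ⁴`: `8`).

## References
* H. Cohn, A. Kumar, J. Amer. Math. Soc. 20 (2007) 99–148, Thm. 1.2, Table 1. [`CohnKumar2006`]
-/

namespace Summit.Ventures.PackingBounds.Energy

open Finset Literature.Analysis.SpecialFunctions Literature.Geometry.DiscreteGeometry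

open scoped Classical in
/-- **Cross-polytope bound for the inverse-square energy, all dimensions**: for `n ≥ 3`, every
`2n` unit vectors of `ℝⁿ` have `Σ_{x ≠ y} |x - y|⁻² ≥ 2n² - 3n/2`, with equality for the regular
cross-polytope. [cite: CohnKumar2006, Theorem 1.2 and Proposition 4.1] -/
theorem crossPolytope_riesz2_energy_ge {n : ℕ} (hn : 3 ≤ n)
    (C : Finset (EuclideanSpace ℝ (Fin n))) (h1 : ∀ x ∈ C, ‖x‖ = 1) (hN : C.card = 2 * n) :
    2 * (n : ℝ) ^ 2 - 3 * n / 2 ≤ ∑ x ∈ C, ∑ y ∈ C.erase x, (‖x - y‖ ^ 2)⁻¹ := by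
  have hn3 : (3 : ℝ) ≤ n := by exact_mod_cast hn
  have key := crossPolytope_energy_ge hn (fun t : ℝ => (2 - 2 * t)⁻¹) (1 / 2) (by norm_num)
    (by norm_num) (by norm_num; positivity) ?_ C h1 hN
  · have hconv : ∑ x ∈ C, ∑ y ∈ C.erase x, (fun t : ℝ => (2 - 2 * t)⁻¹) (inner ℝ x y) =
        ∑ x ∈ C, ∑ y ∈ C.erase x, (‖x - y‖ ^ 2)⁻¹ := by
      refine Finset.sum_congr rfl fun x hx => Finset.sum_congr rfl fun y hy => ?_
      have hyC : y ∈ C := Finset.mem_of_mem_erase hy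
      have hsq : ‖x - y‖ ^ 2 = 2 - 2 * inner ℝ x y := by
        rw [@norm_sub_sq_real, h1 x hx, h1 y hyC]; ring
      show (2 - 2 * inner ℝ x y)⁻¹ = (‖x - y‖ ^ 2)⁻¹
      rw [hsq]
    rw [hconv] at key
    refine le_trans (le_of_eq ?_) key
    norm_num
    ring
  · intro t ht1 ht2
    show (2 - 2 * (0 : ℝ))⁻¹ + 1 / 2 * t +
        ((2 - 2 * (-1 : ℝ))⁻¹ - (2 - 2 * (0 : ℝ))⁻¹ + 1 / 2) * t ^ 2 ≤ (2 - 2 * t)⁻¹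
    have hpos : (0 : ℝ) < 2 - 2 * t := by linarith
    rw [show ((2 : ℝ) - 2 * t)⁻¹ = 1 / (2 - 2 * t) from inv_eq_one_div _, le_div_iff₀ hpos]
    norm_num
    nlinarith [sq_nonneg t, mul_nonneg (sq_nonneg t) (by linarith : (0 : ℝ) ≤ t + 1)]

open scoped Classical in
/-- **Simplex / Jensen bound for the inverse-square energy, all dimensions**: for `n ≥ 3` and
`N ≥ 2`, every `N` unit vectors of `ℝⁿ` have `Σ_{x ≠ y} |x - y|⁻² ≥ (N-1)²/2`, with equality for
the regular simplex when `N ≤ n + 1`. [cite: CohnKumar2006, Theorem 1.2 and Proposition 4.1] -/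
theorem simplex_riesz2_energy_ge {n : ℕ} (hn : 3 ≤ n) (N : ℕ) (hN2 : 2 ≤ N)
    (C : Finset (EuclideanSpace ℝ (Fin n))) (h1 : ∀ x ∈ C, ‖x‖ = 1) (hN : C.card = N) :
    ((N : ℝ) - 1) ^ 2 / 2 ≤ ∑ x ∈ C, ∑ y ∈ C.erase x, (‖x - y‖ ^ 2)⁻¹ := by
  have hN2' : (2 : ℝ) ≤ N := by exact_mod_cast hN2
  have hN1 : (0 : ℝ) < (N : ℝ) - 1 := by linarith
  -- tangent line of a(t) = (2-2t)⁻¹ at t₀ = -1/(N-1): value a₀ = (N-1)/(2N), slope m = (N-1)²/(2N²)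
  set u₀ : ℝ := 2 + 2 / ((N : ℝ) - 1) with hu₀
  have hu₀pos : 0 < u₀ := by rw [hu₀]; positivity
  have ha_t0 : (2 - 2 * (-1 / ((N : ℝ) - 1)))⁻¹ = u₀⁻¹ := by
    rw [hu₀]; ring_nf
  set m : ℝ := 2 / u₀ ^ 2 with hm
  have hmnn : 0 ≤ m := by rw [hm]; positivity
  have key := tangent_energy_ge hn N hN2 (fun t : ℝ => (2 - 2 * t)⁻¹) m hmnn ?_ ?_ C h1 hN
  · have hconv : ∑ x ∈ C, ∑ y ∈ C.erase x, (fun t : ℝ => (2 - 2 * t)⁻¹) (inner ℝ x y) =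
        ∑ x ∈ C, ∑ y ∈ C.erase x, (‖x - y‖ ^ 2)⁻¹ := by
      refine Finset.sum_congr rfl fun x hx => Finset.sum_congr rfl fun y hy => ?_
      have hyC : y ∈ C := Finset.mem_of_mem_erase hy
      have hsq : ‖x - y‖ ^ 2 = 2 - 2 * inner ℝ x y := by
        rw [@norm_sub_sq_real, h1 x hx, h1 y hyC]; ring
      show (2 - 2 * inner ℝ x y)⁻¹ = (‖x - y‖ ^ 2)⁻¹
      rw [hsq]
    rw [hconv, ha_t0] at key
    refine le_trans (le_of_eq ?_) key
    rw [hu₀]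
    field_simp
    ring
  · -- supporting line: a(t₀) + m (t - t₀) ≤ a(t) on [-1, 1)
    intro t ht1 ht2
    rw [ha_t0]
    show u₀⁻¹ + m * (t + 1 / ((N : ℝ) - 1)) ≤ (2 - 2 * t)⁻¹
    have hpos : (0 : ℝ) < 2 - 2 * t := by linarith
    have ht0 : t + 1 / ((N : ℝ) - 1) = (u₀ - (2 - 2 * t)) / 2 := by rw [hu₀]; ring
    rw [ht0, hm]
    rw [show ((2 : ℝ) - 2 * t)⁻¹ = 1 / (2 - 2 * t) from inv_eq_one_div _, le_div_iff₀ hpos]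
    have hu0ne : u₀ ≠ 0 := hu₀pos.ne'
    have hexp : (u₀⁻¹ + 2 / u₀ ^ 2 * ((u₀ - (2 - 2 * t)) / 2)) * (2 - 2 * t) =
        1 - (u₀ - (2 - 2 * t)) ^ 2 / u₀ ^ 2 := by
      field_simp
      ring
    rw [hexp]
    have hsq : 0 ≤ (u₀ - (2 - 2 * t)) ^ 2 / u₀ ^ 2 := by positivity
    linarith
  · -- a(t₀) + m/(N-1) ≥ 0
    rw [ha_t0]
    positivity

end Summit.Ventures.PackingBounds.Energy
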